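import Summits.KontsevichZagierPeriods.KontsevichZagierPeriods.Theorems.LinRedNormalFormArrangementNormalFormSeparateTwoPosLetters
import Summits.KontsevichZagierPeriods.KontsevichZagierPeriods.Theorems.LinRedNormalFormArrangementNormalFormSeparateSplit
import Summits.KontsevichZagierPeriods.KontsevichZagierPeriods.Theorems.LinRedNormalFormArrangementNormalFormSeparateTaylor

/-!
# The terminal step with fibres: the Taylor split, given its termwise convergence lemma

(Line `janus-bands`, crux `ArrangementNormalForm`, stub `stub_separateTwoPos` — separation in a
good rational direction for planar Janus band representations WITH `k` fibres; part `Terminal`.)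

`SepTwoPos.terminal` (registered as `separateTwoPos_terminal`): a terminal representation of the
far-first separation with fibres (polygonal base cell × fibres, separation shape with all active
`y`-letters equal to `ℓ`, every wall harmless or through the vertex `V` with the cone condition
and `ℓ ∋ V` — the wall invariant of `SepTwoPos.sepV_induction`) is congruent modulo
`KZ.relations` to a `ℤ`-combination of elements of `GG 1 1 k`, GIVEN (hypothesis `hHI`, the
statement of the analytic lemma `stub_separateTwoPos_hI`, universally closed) the termwise
absolute convergence of the Taylor split for pieces satisfying `hH` (every active `x`-letter
vanishes on the closed piece only on the pole line): the wall invariant implies `hH` (a wall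
through `V` vanishes only over `x = V₁`, where the closed cone pinches the cell to the point `V`
of the pole line), Taylor data `separatePos_taylor`, `hI := hHI`, and `separatePos_split`.
-/

noncomputable section

open Set MeasureTheory Filter Topology

namespace Summit.KontsevichZagierPeriods.ArrangementNormalForm.JanusBands

open Literature.NumberTheory.Transcendental

namespace SepTwoPos

open SeparatePos SepTwoZero

section Terminal

variable {k : ℕ}

/-- **The wall invariant implies `hH`.** If every active `x`-letter is harmless (bounded away
from zero on the cell) or a wall through the vertex `V` with the cone condition at `V` and the
pole line `ℓ ∋ V`, then an active `x`-letter vanishing at a point of the CLOSED cell forces that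
point onto the pole line (and `n ≠ 0`). [folklore] -/
theorem hH_of_inv {m : ℕ} (L : Fin m → (Fin 1 → ℚ) × ℚ) (e : Fin m → ℕ) (ℓ : (Fin 1 → ℚ) × ℚ)
    (σ : Set (Fin (1 + 1 + k) → ℝ)) (n : ℕ) (V : ℚ × ℚ)
    (hInv : ∀ j, e j ≠ 0 → (∃ c₀ > 0, ∀ z ∈ σ, c₀ ≤ |affB 1 k (L j) z|) ∨
      ((L j).1 0 ≠ 0 ∧ (L j).1 0 * V.1 + (L j).2 = 0 ∧ n ≠ 0 ∧ ℓ.1 0 * V.1 + ℓ.2 = V.2 ∧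
        ∃ a₁ b₁ : ℚ, ∀ z ∈ σ, (a₁ : ℝ) * (z (Fin.castAdd k 0) - V.1) < z (Fin.castAdd k 1) - V.2 ∧
          z (Fin.castAdd k 1) - V.2 < (b₁ : ℝ) * (z (Fin.castAdd k 0) - V.1))) :
    ∀ j, e j ≠ 0 → ∀ z ∈ closure σ, affB 1 k (L j) z = 0 →
      (n ≠ 0 ∧ z (Fin.castAdd k (Fin.last 1)) = affB 1 k ℓ z) := by
  intro j he z hz h0
  rcases hInv j he with ⟨c₀, hc₀, hb⟩ | ⟨hk, hkV, hn, hℓV, a₁, b₁, hcone⟩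
  · have := le_of_mem_closure' (f := fun _ => c₀) (g := fun z => |affB 1 k (L j) z|)
      continuous_const (by simp only [affB_eq]; fun_prop) hb hz
    rw [h0, abs_zero] at this; linarith
  · have hk' : ((L j).1 0 : ℝ) ≠ 0 := by exact_mod_cast hk
    have hkV' : ((L j).1 0 : ℝ) * V.1 + (L j).2 = 0 := by exact_mod_cast hkV
    rw [affB_eq] at h0
    have hxV : z (Fin.castAdd k 0) = V.1 := by
      have : ((L j).1 0 : ℝ) * (z (Fin.castAdd k 0) - V.1) = 0 := by linarith
      simpa [hk', sub_eq_zero] using this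
    have h1 := le_of_mem_closure' (f := fun z : Fin (1 + 1 + k) → ℝ =>
        (a₁ : ℝ) * (z (Fin.castAdd k 0) - V.1)) (g := fun z => z (Fin.castAdd k 1) - V.2)
      (by fun_prop) (by fun_prop) (fun z hz => (hcone z hz).1.le) hz
    have h2 := le_of_mem_closure' (f := fun z : Fin (1 + 1 + k) → ℝ => z (Fin.castAdd k 1) - V.2)
      (g := fun z => (b₁ : ℝ) * (z (Fin.castAdd k 0) - V.1)) (by fun_prop) (by fun_prop)
      (fun z hz => (hcone z hz).2.le) hz
    simp only [hxV, sub_self, mul_zero] at h1 h2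
    have hy : z (Fin.castAdd k 1) = V.2 := by linarith
    have hℓV' : (ℓ.1 0 : ℝ) * V.1 + ℓ.2 = V.2 := by exact_mod_cast hℓV
    refine ⟨hn, ?_⟩
    rw [cA1, affB_eq, hy, hxV, hℓV']

/-- **Terminal theorem with fibres.** A terminal representation of the far-first separation
(polygonal base cell × fibres, separation shape with all active `y`-letters equal to `ℓ`, walls
either bounded away from zero on the cell or through the vertex `V` with the cone condition and
`ℓ ∋ V`) is congruent modulo `KZ.relations` to a `ℤ`-combination of elements of `GG 1 1 k`,
given the termwise-convergence lemma `hHI` of the Taylor split under `hH`: Taylor data at `ℓ`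
(`separatePos_taylor`), `hH` from the wall invariant (`hH_of_inv`), `hI := hHI`, and the
numerator split `separatePos_split` (rule 1b). [Kontsevich–Zagier 2001, §1.2] -/
theorem terminal {m' r : ℕ} (M : Fin m' → (Fin (1 + 1) → ℚ) × ℚ)
    (p : MvPolynomial (Fin (1 + 1)) ℚ) (lam : Fin r → (Fin 1 → ℚ) × ℚ)
    (a : Fin k → Option ((Fin (1 + 1) → ℚ) × ℚ))
    (lo up : Fin k → Fin k ⊕ ((Fin (1 + 1) → ℚ) × ℚ)) (V : ℚ × ℚ)
    (hHI : ∀ (b k m m' n : ℕ) (s : KZ.IntegralRep (b + 1 + k)) (M : Fin m' → (Fin (b + 1) → ℚ) × ℚ) (L : Fin m → (Fin b → ℚ) × ℚ) (e : Fin m → ℕ) (p : MvPolynomial (Fin (b + 1)) ℚ) (ℓ : (Fin b → ℚ) × ℚ) (a : Fin k → Option ((Fin (b + 1) → ℚ) × ℚ)) (lo hi : Fin k → Fin k ⊕ ((Fin (b + 1) → ℚ) × ℚ)) (hpole : n ≠ 0 → ∀ z ∈ s.domain, (z (Fin.castAdd k (Fin.last b)) - (∑ i, (ℓ.1 i : ℝ)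 * z (Fin.castAdd k (Fin.castSucc i)) + (ℓ.2 : ℝ))) ≠ 0) (hbd : Bornology.IsBounded s.domain) (hdom : s.domain = {z | (∀ j, 0 < ∑ i, ((M j).1 i : ℝ) * z (Fin.castAdd k i) + ((M j).2 : ℝ)) ∧ ∀ i, Sum.elim (fun j => z (Fin.natAdd (b + 1) j)) (fun c => ∑ i', (c.1 i' : ℝ) * z (Fin.castAdd k i') + (c.2 : ℝ)) (lo i) < z (Fin.natAdd (b + 1) i) ∧ z (Fin.natAdd (b + 1) i) < Sum.elim (fun j => z (Fin.natAdd (b + 1) j)) (fun c => ∑ i', (c.1 i' : ℝ) * z (Fin.castAdd k i') + (c.2 : ℝ)) (hi i)}) (hint : EqOn s.integrand (fun z => MvPolynomial.aeval (fun i => z (Fin.castAdd k i)) p / (∏ j, (∑ i, ((L j).1 i : ℝ) * z (Fin.castAdd k (Fin.castSucc i)) + ((L j).2 : ℝ)) ^ e j) * (1 / (z (Fin.castAdd k (Fin.last b)) - (∑ i, (ℓ.1 i : ℝ) * z (Fin.castAdd k (Fin.castSucc i)) + (ℓ.2 : ℝ))) ^ n) * ∏ i, (a i).elim 1 (fun c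 => 1 / (z (Fin.natAdd (b + 1) i) - (∑ i', (c.1 i' : ℝ) * z (Fin.castAdd k i') + (c.2 : ℝ))))) s.domain) (N : ℕ) (q : ℕ → MvPolynomial (Fin b) ℚ) (hq : ∀ z : Fin (b + 1 + k) → ℝ, MvPolynomial.aeval (fun i => z (Fin.castAdd k i)) p = ∑ i ∈ Finset.range N, MvPolynomial.aeval (fun i => z (Fin.castAdd k (Fin.castSucc i))) (q i) * (z (Fin.castAdd k (Fin.last b)) - (∑ i, (ℓ.1 i : ℝ) * z (Fin.castAdd k (Fin.castSucc i)) + (ℓ.2 : ℝ))) ^ i) (hb : b = 1) (hH : ∀ j, e j ≠ 0 → ∀ z ∈ closure s.domain, (∑ i, ((L j).1 i : ℝ) * z (Fin.castAdd k (Fin.castSucc i)) + ((L j).2 : ℝ)) = 0 → (n ≠ 0 ∧ z (Fin.castAdd k (Fin.last b)) = ∑ i, (ℓ.1 i : ℝ) * z (Fin.castAdd k (Fin.castSucc i)) + (ℓ.2 : ℝ))), ∀ i ∈ Finset.range N, IntegrableOn (fun z => MvPolynomial.aeval (fun i => z (Fin.castAdd k (Fin.castSucc i))) (q i) / (∏ j,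 (∑ i, ((L j).1 i : ℝ) * z (Fin.castAdd k (Fin.castSucc i)) + ((L j).2 : ℝ)) ^ e j) * ((z (Fin.castAdd k (Fin.last b)) - (∑ i, (ℓ.1 i : ℝ) * z (Fin.castAdd k (Fin.castSucc i)) + (ℓ.2 : ℝ))) ^ i / (z (Fin.castAdd k (Fin.last b)) - (∑ i, (ℓ.1 i : ℝ) * z (Fin.castAdd k (Fin.castSucc i)) + (ℓ.2 : ℝ))) ^ n) * ∏ i, (a i).elim 1 (fun c => 1 / (z (Fin.natAdd (b + 1) i) - (∑ i', (c.1 i' : ℝ) * z (Fin.castAdd k i') + (c.2 : ℝ))))) s.domain)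
    {m : ℕ} (L : Fin m → (Fin 1 → ℚ) × ℚ) (e : Fin m → ℕ) (d : Fin r → ℕ)
    (s : KZ.IntegralRep (1 + 1 + k)) (ℓ : (Fin 1 → ℚ) × ℚ)
    (hbd : Bornology.IsBounded s.domain) (hdom : s.domain = gDom 1 k m' M lo up)
    (hint : EqOn s.integrand (shape 1 k p L e lam d a) s.domain)
    (hpole : ∀ j, d j ≠ 0 → ∀ z ∈ s.domain,
      z (Fin.castAdd k (Fin.last 1)) - affB 1 k (lam j) z ≠ 0)
    (hℓ : ∀ j, d j ≠ 0 → lam j = ℓ)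
    (hInv : ∀ j, e j ≠ 0 → (∃ c₀ > 0, ∀ z ∈ s.domain, c₀ ≤ |affB 1 k (L j) z|) ∨
      ((L j).1 0 ≠ 0 ∧ (L j).1 0 * V.1 + (L j).2 = 0 ∧ (∃ i, d i ≠ 0) ∧
        (∀ i, d i ≠ 0 → (lam i).1 0 * V.1 + (lam i).2 = V.2) ∧
        ∃ a₁ b₁ : ℚ, ∀ z ∈ s.domain, (a₁ : ℝ) * (z (Fin.castAdd k 0) - V.1) <
          z (Fin.castAdd k 1) - V.2 ∧
          z (Fin.castAdd k 1) - V.2 < (b₁ : ℝ) * (z (Fin.castAdd k 0) - V.1))) :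
    ∃ c ∈ AddSubgroup.closure (GGset 1 1 k), KZ.of s - c ∈ KZ.relations := by
  set n := ∑ j, d j with hn
  -- single-pole form of the integrand
  have hint' : EqOn s.integrand (fun z => MvPolynomial.aeval (fun i => z (Fin.castAdd k i)) p /
      (∏ j, (∑ i, ((L j).1 i : ℝ) * z (Fin.castAdd k (Fin.castSucc i)) + ((L j).2 : ℝ)) ^ e j) *
      (1 / (z (Fin.castAdd k (Fin.last 1)) - (∑ i, (ℓ.1 i : ℝ) * z (Fin.castAdd k
        (Fin.castSucc i)) + (ℓ.2 : ℝ))) ^ n) *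
      ∏ i, (a i).elim 1 (fun c => 1 / (z (Fin.natAdd (1 + 1) i) -
        (∑ i', (c.1 i' : ℝ) * z (Fin.castAdd k i') + (c.2 : ℝ))))) s.domain := by
    intro z hz
    rw [hint hz]
    simp only [shape, fib, affB, one_div]
    congr 2
    rw [← Finset.prod_pow_eq_pow_sum, ← Finset.prod_inv_distrib]
    refine Finset.prod_congr rfl fun j _ => ?_
    by_cases hj : d j = 0
    · simp [hj]
    · rw [hℓ j hj]
  have hact : n ≠ 0 → ∃ j, d j ≠ 0 := fun h => by
    by_contra hall; push Not at hall
    exact h (Finset.sum_eq_zero fun j _ => hall j)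
  have hpole' : n ≠ 0 → ∀ z ∈ s.domain, z (Fin.castAdd k (Fin.last 1)) -
      (∑ i, (ℓ.1 i : ℝ) * z (Fin.castAdd k (Fin.castSucc i)) + (ℓ.2 : ℝ)) ≠ 0 := fun h z hz => by
    obtain ⟨j, hj⟩ := hact h
    have := hpole j hj z hz
    rwa [hℓ j hj] at this
  obtain ⟨N, q, hq⟩ := separatePos_taylor 1 k p ℓ
  -- the wall invariant in single-pole form, and `hH`
  have hInv' : ∀ j, e j ≠ 0 → (∃ c₀ > 0, ∀ z ∈ s.domain, c₀ ≤ |affB 1 k (L j) z|) ∨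
      ((L j).1 0 ≠ 0 ∧ (L j).1 0 * V.1 + (L j).2 = 0 ∧ n ≠ 0 ∧ ℓ.1 0 * V.1 + ℓ.2 = V.2 ∧
        ∃ a₁ b₁ : ℚ, ∀ z ∈ s.domain, (a₁ : ℝ) * (z (Fin.castAdd k 0) - V.1) <
          z (Fin.castAdd k 1) - V.2 ∧
          z (Fin.castAdd k 1) - V.2 < (b₁ : ℝ) * (z (Fin.castAdd k 0) - V.1)) := by
    intro j hj
    rcases hInv j hj with h | ⟨h1, h2, ⟨i₀, hi₀⟩, h4, h5⟩
    · exact Or.inl h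
    · refine Or.inr ⟨h1, h2, fun h0 => hi₀ ((Finset.sum_eq_zero_iff.1 h0) i₀ (Finset.mem_univ _)),
        ?_, h5⟩
      rw [← hℓ i₀ hi₀]; exact h4 i₀ hi₀
  have hH : ∀ j, e j ≠ 0 → ∀ z ∈ closure s.domain,
      (∑ i, ((L j).1 i : ℝ) * z (Fin.castAdd k (Fin.castSucc i)) + ((L j).2 : ℝ)) = 0 →
      (n ≠ 0 ∧ z (Fin.castAdd k (Fin.last 1)) =
        ∑ i, (ℓ.1 i : ℝ) * z (Fin.castAdd k (Fin.castSucc i)) + (ℓ.2 : ℝ)) :=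
    hH_of_inv L e ℓ s.domain n V hInv'
  exact separatePos_split GGset (fun _ _ _ => rfl) 1 k m m' n s M L e p ℓ a lo up hpole' hbd hdom
    hint' N q hq (hHI 1 k m m' n s M L e p ℓ a lo up hpole' hbd hdom hint' N q hq rfl hH)

end Terminal

end SepTwoPos

open SepTwoPos SepTwoZero SeparatePos in
/-- **Terminal theorem with fibres** (registered part of `stub_separateTwoPos`; see `SepTwoPos.terminal`). [Kontsevich–Zagier 2001, §1.2] -/
theorem separateTwoPos_terminal (k : ℕ) {m' r : ℕ} (M : Fin m' → (Fin (1 + 1) → ℚ) × ℚ) (p : MvPolynomial (Fin (1 + 1)) ℚ) (lam : Fin r → (Fin 1 → ℚ) × ℚ) (a : Fin k → Option ((Fin (1 + 1) → ℚ) × ℚ)) (lo up : Fin k → Fin k ⊕ ((Fin (1 + 1) → ℚ) × ℚ)) (V : ℚ × ℚ) (hHI : ∀ (b k m m' n : ℕ) (s : KZ.IntegralRep (b + 1 + k)) (M : Fin m' → (Fin (b + 1) → ℚ) × ℚ) (L : Fin m → (Fin b → ℚ) × ℚ) (e : Fin m → ℕ) (p : MvPolynomial (Fin (b + 1)) ℚ)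 (ℓ : (Fin b → ℚ) × ℚ) (a : Fin k → Option ((Fin (b + 1) → ℚ) × ℚ)) (lo hi : Fin k → Fin k ⊕ ((Fin (b + 1) → ℚ) × ℚ)) (hpole : n ≠ 0 → ∀ z ∈ s.domain, (z (Fin.castAdd k (Fin.last b)) - (∑ i, (ℓ.1 i : ℝ) * z (Fin.castAdd k (Fin.castSucc i)) + (ℓ.2 : ℝ))) ≠ 0) (hbd : Bornology.IsBounded s.domain) (hdom : s.domain = {z | (∀ j, 0 < ∑ i, ((M j).1 i : ℝ) * z (Fin.castAdd k i) + ((M j).2 : ℝ)) ∧ ∀ i, Sum.elim (fun j => z (Fin.natAdd (b + 1) j)) (fun c => ∑ i', (c.1 i' : ℝ) * z (Fin.castAdd k i') + (c.2 : ℝ)) (lo i) < z (Fin.natAdd (b + 1) i) ∧ z (Fin.natAdd (b + 1) i) < Sum.elim (fun j => z (Fin.natAdd (b + 1) j)) (fun c => ∑ i', (c.1 i' : ℝ) * z (Fin.castAdd k i') + (c.2 : ℝ)) (hi i)}) (hint : EqOn s.integrand (fun z => MvPolynomial.aeval (fun i => z (Fin.castAdd k i)) p / (∏ j, (∑ i,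 ((L j).1 i : ℝ) * z (Fin.castAdd k (Fin.castSucc i)) + ((L j).2 : ℝ)) ^ e j) * (1 / (z (Fin.castAdd k (Fin.last b)) - (∑ i, (ℓ.1 i : ℝ) * z (Fin.castAdd k (Fin.castSucc i)) + (ℓ.2 : ℝ))) ^ n) * ∏ i, (a i).elim 1 (fun c => 1 / (z (Fin.natAdd (b + 1) i) - (∑ i', (c.1 i' : ℝ) * z (Fin.castAdd k i') + (c.2 : ℝ))))) s.domain) (N : ℕ) (q : ℕ → MvPolynomial (Fin b) ℚ) (hq : ∀ z : Fin (b + 1 + k) → ℝ, MvPolynomial.aeval (fun i => z (Fin.castAdd k i)) p = ∑ i ∈ Finset.range N, MvPolynomial.aeval (fun i => z (Fin.castAdd k (Fin.castSucc i))) (q i) * (z (Fin.castAdd k (Fin.last b)) - (∑ i, (ℓ.1 i : ℝ) * z (Fin.castAdd k (Fin.castSucc i)) + (ℓ.2 : ℝ))) ^ i) (hb : b = 1) (hH : ∀ j, e j ≠ 0 → ∀ z ∈ closure s.domain, (∑ i, ((L j).1 i : ℝ) * z (Fin.castAdd k (Fin.castSucc i)) + ((L j).2 : ℝ)) = 0 →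 (n ≠ 0 ∧ z (Fin.castAdd k (Fin.last b)) = ∑ i, (ℓ.1 i : ℝ) * z (Fin.castAdd k (Fin.castSucc i)) + (ℓ.2 : ℝ))), ∀ i ∈ Finset.range N, IntegrableOn (fun z => MvPolynomial.aeval (fun i => z (Fin.castAdd k (Fin.castSucc i))) (q i) / (∏ j, (∑ i, ((L j).1 i : ℝ) * z (Fin.castAdd k (Fin.castSucc i)) + ((L j).2 : ℝ)) ^ e j) * ((z (Fin.castAdd k (Fin.last b)) - (∑ i, (ℓ.1 i : ℝ) * z (Fin.castAdd k (Fin.castSucc i)) + (ℓ.2 : ℝ))) ^ i / (z (Fin.castAdd k (Fin.last b)) - (∑ i, (ℓ.1 i : ℝ) * z (Fin.castAdd k (Fin.castSucc i)) + (ℓ.2 : ℝ))) ^ n) * ∏ i, (a i).elim 1 (fun c => 1 / (z (Fin.natAdd (b + 1) i) - (∑ i', (c.1 i' : ℝ) * z (Fin.castAdd k i') + (c.2 : ℝ))))) s.domain) {m : ℕ} (L : Fin m → (Fin 1 → ℚ) × ℚ) (e : Fin m → ℕ) (d : Fin r → ℕ) (s : KZ.IntegralRep (1 + 1 + k)) (ℓ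 : (Fin 1 → ℚ) × ℚ) (hbd : Bornology.IsBounded s.domain) (hdom : s.domain = gDom 1 k m' M lo up) (hint : EqOn s.integrand (shape 1 k p L e lam d a) s.domain) (hpole : ∀ j, d j ≠ 0 → ∀ z ∈ s.domain, z (Fin.castAdd k (Fin.last 1)) - affB 1 k (lam j) z ≠ 0) (hℓ : ∀ j, d j ≠ 0 → lam j = ℓ) (hInv : ∀ j, e j ≠ 0 → (∃ c₀ > 0, ∀ z ∈ s.domain, c₀ ≤ |affB 1 k (L j) z|) ∨ ((L j).1 0 ≠ 0 ∧ (L j).1 0 * V.1 + (L j).2 = 0 ∧ (∃ i, d i ≠ 0) ∧ (∀ i, d i ≠ 0 → (lam i).1 0 * V.1 + (lam i).2 = V.2) ∧ ∃ a₁ b₁ : ℚ, ∀ z ∈ s.domain, (a₁ : ℝ) * (z (Fin.castAdd k 0) - V.1) < z (Fin.castAdd k 1) - V.2 ∧ z (Fin.castAdd k 1) - V.2 < (b₁ : ℝ) * (z (Fin.castAdd k 0) - V.1))) : ∃ c ∈ AddSubgroup.closure (GGset 1 1 k), KZ.of s - c ∈ KZ.relations := by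
  exact SepTwoPos.terminal M p lam a lo up V hHI L e d s ℓ hbd hdom hint hpole hℓ hInv


end Summit.KontsevichZagierPeriods.ArrangementNormalForm.JanusBands
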